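/-
Copyright: statement-level skeleton of a published paper (lit-balaban cell, Phase-2 proof seat p20 gen 7). No proof claims
beyond what the kernel checks below.
-/
import Literature.MathematicalPhysics.QuantumFieldTheory.Balaban1983to89.B3CxiDifferenceKernel
import Literature.MathematicalPhysics.QuantumFieldTheory.Balaban1983to89.B3CxiBesselSecondDifference

/-!
# B3 — T. Bałaban, *(Higgs)₂,₃ quantum fields in a finite volume. III. Renormalization*, CMP **88** (1983) 411–445
[Balaban1983Higgs3], (2.10) p. 426 / p. 437: the SECOND-ORDER member of the printed clause *"and the corresponding inequalities
for derivatives"* for the free propagator C^ξ = (−Δ^ξ+1)^{−1} on ξℤ³ — FILE 2/3: the SECOND-DIFFERENCE KERNELS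
e^{−t}·Δ_{ν′}Δ_νQ(θt)(y) (mixed, ν ≠ ν′, any signs of the two unit steps) and e^{−t}·[Q(θt)(y+e_ν) − 2Q(θt)(y) + Q(θt)(y−e_ν)] (pure,
centred) of the Poissonized representation, and their pointwise bounds in the two regimes (d = 3)

statement-level skeleton of published theorems with citation tags; proofs where landed; nothing here is a claim about
the Yang–Mills mass gap

PDF held: `paper:balaban1983-higgs-2-3-quantum-fields-finite-volume` (journal page = PDF page + 410), p. 426 [PDF 16] and p. 437
[PDF 27].
WHAT IS REPRODUCED: kernel infrastructure for rows **B3.Eq2.10** / **B3.Eq3.11-3.17** of `HOME/lit-balaban-r15/ROWS-B3.md`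
(reader/typer r15, fold owner of B3) — (2.10) p. 426 *"for each differentiation ∂^η … an additional factor (L^jη)^{−1} … appears
on the right side"*, read at second order for the free propagator, and the p. 437 sentence *"… and the corresponding inequalities
for derivatives"*: the middle file of the proof of **|∂^ξ_{ν′}∂^ξ_νC^ξ(y)| ≤ O(1)·e^{−ξ|y|/2}/(ξ|y|)³ on ξℤ³, uniformly in 0 < ξ ≤ 1**
(file 3: `B3CxiSecondDifferenceBound`), one order beyond seat p39's first-difference chain `B3CxiBesselDifference` →
`B3CxiDifferenceKernel` → `B3CxiDerivativeBound`, whose architecture is mirrored line by line.  By p39's Poissonization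
(`B3CxiPoissonization.Cxi_eq_poissonK`) C^ξ(y) = θξ²ξ^{−3}∫₀^∞e^{−t}Q(θt)(y)dt, Q(s)(y) = Π_μG(s,y_μ), θ = (6+ξ²)^{−1}, so every second
difference of C^ξ is the t-integral of e^{−t} times the corresponding second difference of the separated kernel Q(θt):
§1 (algebra) **Δ^{c′}_{ν′}Δ^{c}_νQ(s)(y) = [G(s,y_ν+c) − G(s,y_ν)]·[G(s,y_{ν′}+c′) − G(s,y_{ν′})]·Π_{μ∉{ν,ν′}}G(s,y_μ)** for ν ≠ ν′ and
any integer steps c, c′ (`Q_mixedDiff`), and **Q(s)(y+e_ν) − 2Q(s)(y) + Q(s)(y−e_ν) = [G(s,y_ν+1) − 2G(s,y_ν) + G(s,y_ν−1)]·Π_{μ≠ν}G(s,y_μ)**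
(`Q_pureDiff`).  §2 (tilts) with p39's one-step factor |G(s,n±1) − G(s,n)| ≤ (2/√(1+s))e^{2s cosh a − a|n|}(5/(4√(1+s)) + e^a − 1)
(`abs_G_step_sub_le`, both signs by evenness of G) and file 1's centred second-difference factor
`B3CxiBesselSecondDifference.abs_G_secondDiff_le` (extra factor 10e^a/(1+s) + (5/2)(e^a−1)/√(1+s) + 2(cosh a − 1)):
|Δ_{ν′}Δ_νQ(s)(y)| ≤ (2/√(1+s))^d·exp(Σ_μ(2s cosh a_μ − a_μ|y_μ|))·E₁(a_ν)E₁(a_{ν′}) (`ddQ_mixed_le_tilt`) and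
|Δ²_νQ(s)(y)| ≤ (2/√(1+s))^d·exp(Σ_μ(…))·E₂(a_ν) (`ddQ_pure_le_tilt`) for tilts a_μ ≥ 0.  §3 (the two regimes of
`B3CxiUniformBound`, d = 3, N = |y|_∞, R² = Σ_μy_μ²): Gaussian tilts a_μ = 5|y_μ|/(14s) ∈ [0,2] when 5N ≤ 28s, where e^a ≤ e² ≤ 7.39,
e^a − 1 ≤ (16/5)a, cosh a − 1 ≤ e^{a²/2} − 1 ≤ (8/5)a² (Mathlib's `Real.cosh_le_exp_half_sq` and the chord of exp on [0,2]) give both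
extra factors ≤ 74/(1+s) + (20/7)N/(s√(1+s)) + (64/49)N²/s²; the tilt 2 at a largest coordinate otherwise, extra factors ≤ 96:
**|ΔΔQ(s)(y)| ≤ (2/√(1+s))³·[e^{6s − (5/28)R²/s}(74/(1+s) + (20/7)N/(s√(1+s)) + (64/49)N²/s²) + 96·e^{6s − N}]** (`ddQ_mixed_three_le`,
`ddQ_pure_three_le`, through the shared `two_regime_bound`).  §4: with e^{−t}e^{6θt} = e^{−ξ²θt}, completing the square and the
prefactor bounds (2/√(1+u))³/(1+u) ≤ 8u^{−5/2}, (2/√(1+u))⁴/(2u) ≤ 8u^{−3}, (2/√(1+u))³/u² ≤ 8u^{−7/2}, the pointwise bound of both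
second-difference integrands **≤ e^{−ξR/2}[592(θt)^{−5/2} + (160/7)N(θt)^{−3} + (512/49)N²(θt)^{−7/2}]e^{−(R²/14)/(θt)} + 96e^{−N}(2/√(1+θt))³**
(`abs_integrand_mixedDiff_three_le`, `abs_integrand_pureDiff_three_le`) — one power (θt)^{−1/2} more than p39's first-difference
integrand in each Gaussian term, which is what turns 1/|y|² into 1/|y|³ in file 3.  Mathlib + the cited tree files only; theorems
only, no new definitions, no named facts; standard axioms.  Unit `lit-balaban-p20-g7` (Phase-2 proof seat p20, gen 7), HOME
`run/shared/lean/pub/lit-balaban/`, 2026-08-21.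
-/

open scoped BigOperators Topology
open Real MeasureTheory Set Filter

namespace Literature.MathematicalPhysics.QuantumFieldTheory.Balaban1983to89.B3CxiSecondDifferenceKernel

open B3Sect3VectorSelfEnergy B3CxiPropagator B3CxiBesselKernel B3CxiPoissonization B3CxiUniformBound B3CxiBesselDifference
  B3CxiDifferenceKernel B3CxiBesselSecondDifference

noncomputable section

variable {d : ℕ} {ξ : ℝ}

/-! ## 1. Algebra of the separated kernel: mixed and pure second differences of Q(s)(y) = Π_μ G(s,y_μ) -/

/-- kernel: coordinates of a shifted site, (y + c·e_ν)_μ = y_μ + c·[μ = ν]. [folklore] -/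
private theorem shift_apply (y : ZSite d) (ν μ : Fin d) (c : ℤ) :
    (y + c • unitVec ν) μ = y μ + if μ = ν then c else 0 := by
  by_cases h : μ = ν
  · subst h; simp [unitVec]
  · simp [unitVec, h]

/-- kernel: y − e_ν = y + (−1)·e_ν. [folklore] -/
private theorem sub_unitVec_eq (y : ZSite d) (ν : Fin d) : y - unitVec ν = y + (-1 : ℤ) • unitVec ν := by
  funext μ
  rw [Pi.sub_apply, shift_apply]
  by_cases h : μ = ν
  · subst h; simp [unitVec]; omega
  · simp [unitVec, h]

/-- kernel: for ν ≠ ν′, Q(s)(y) = G(s,y_ν)·G(s,y_{ν′})·Π_{μ∉{ν,ν′}}G(s,y_μ). [cite: Balaban1983Higgs3, (2.10) p.426] -/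
theorem Q_eq_mul_mul_prod (s : ℝ) (y : ZSite d) {ν ν' : Fin d} (hne : ν ≠ ν') :
    Q s y = G s (y ν) * G s (y ν') * ∏ μ ∈ (Finset.univ.erase ν).erase ν', G s (y μ) := by
  have hmem : ν' ∈ Finset.univ.erase ν := Finset.mem_erase.mpr ⟨hne.symm, Finset.mem_univ _⟩
  unfold Q
  rw [← Finset.mul_prod_erase Finset.univ (fun μ => G s (y μ)) (Finset.mem_univ ν),
    ← Finset.mul_prod_erase (Finset.univ.erase ν) (fun μ => G s (y μ)) hmem, mul_assoc]

/-- **Mixed second difference of the separated kernel** (ν ≠ ν′, arbitrary integer steps c, c′; c, c′ ∈ {±1} below):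
Q(s)(y+c·e_ν+c′·e_{ν′}) − Q(s)(y+c·e_ν) − Q(s)(y+c′·e_{ν′}) + Q(s)(y) = [G(s,y_ν+c) − G(s,y_ν)]·[G(s,y_{ν′}+c′) − G(s,y_{ν′})]·Π_{μ∉{ν,ν′}}G(s,y_μ).
[cite: Balaban1983Higgs3, (2.10) p.426] -/
theorem Q_mixedDiff (s : ℝ) (y : ZSite d) {ν ν' : Fin d} (hne : ν ≠ ν') (c c' : ℤ) :
    Q s (y + c • unitVec ν + c' • unitVec ν') - Q s (y + c • unitVec ν) - Q s (y + c' • unitVec ν') + Q s y =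
      (G s (y ν + c) - G s (y ν)) * (G s (y ν' + c') - G s (y ν')) *
        ∏ μ ∈ (Finset.univ.erase ν).erase ν', G s (y μ) := by
  have hP : ∀ z : ZSite d, (∀ μ, μ ≠ ν → μ ≠ ν' → z μ = y μ) →
      ∏ μ ∈ (Finset.univ.erase ν).erase ν', G s (z μ) = ∏ μ ∈ (Finset.univ.erase ν).erase ν', G s (y μ) := by
    intro z hz
    refine Finset.prod_congr rfl fun μ hμ => ?_
    have h1 : μ ≠ ν' := Finset.ne_of_mem_erase hμ
    have h2 : μ ≠ ν := Finset.ne_of_mem_erase (Finset.mem_of_mem_erase hμ)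
    rw [hz μ h2 h1]
  have e1 := Q_eq_mul_mul_prod s (y + c • unitVec ν + c' • unitVec ν') hne
  have e2 := Q_eq_mul_mul_prod s (y + c • unitVec ν) hne
  have e3 := Q_eq_mul_mul_prod s (y + c' • unitVec ν') hne
  have e4 := Q_eq_mul_mul_prod s y hne
  rw [hP _ (fun μ h2 h1 => by rw [shift_apply, shift_apply, if_neg h2, if_neg h1, add_zero, add_zero])] at e1
  rw [hP _ (fun μ h2 _ => by rw [shift_apply, if_neg h2, add_zero])] at e2
  rw [hP _ (fun μ _ h1 => by rw [shift_apply, if_neg h1, add_zero])] at e3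
  simp only [shift_apply, ite_true, if_neg hne, if_neg hne.symm, add_zero] at e1 e2 e3
  rw [e1, e2, e3, e4]
  ring

/-- **Pure (centred) second difference of the separated kernel**:
Q(s)(y+e_ν) − 2Q(s)(y) + Q(s)(y−e_ν) = [G(s,y_ν+1) − 2G(s,y_ν) + G(s,y_ν−1)]·Π_{μ≠ν}G(s,y_μ). [cite: Balaban1983Higgs3, (2.10) p.426] -/
theorem Q_pureDiff (s : ℝ) (y : ZSite d) (ν : Fin d) :
    Q s (y + unitVec ν) - 2 * Q s y + Q s (y - unitVec ν) =
      (G s (y ν + 1) - 2 * G s (y ν) + G s (y ν - 1)) * ∏ μ ∈ Finset.univ.erase ν, G s (y μ) := by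
  have h1 := Q_shift s y ν 1
  rw [one_smul] at h1
  have h2 := Q_shift s y ν (-1)
  rw [← sub_unitVec_eq, show y ν + -1 = y ν - 1 by ring] at h2
  have h0 : Q s y = G s (y ν) * ∏ μ ∈ Finset.univ.erase ν, G s (y μ) := by
    unfold Q
    rw [Finset.mul_prod_erase Finset.univ (fun μ => G s (y μ)) (Finset.mem_univ ν)]
  rw [h1, h2, h0]
  ring

/-! ## 2. Tilted bounds: the one-step factor for both signs, and the two second differences with arbitrary tilts a_μ ≥ 0 -/

section Tilt

variable {s a : ℝ}

/-- kernel (p39's one-step factor for either sign of the step, by evenness of G(s,·)): for s, a ≥ 0, n ∈ ℤ and c ∈ {1, −1},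
|G(s,n+c) − G(s,n)| ≤ (2/√(1+s))·e^{2s cosh a − a|n|}·(5/(4√(1+s)) + (e^a − 1)). [cite: Balaban1983Higgs3, (2.10) p.426] -/
theorem abs_G_step_sub_le (hs : 0 ≤ s) (ha : 0 ≤ a) (n c : ℤ) (hc : c = 1 ∨ c = -1) :
    |G s (n + c) - G s n| ≤
      2 / Real.sqrt (1 + s) * Real.exp (2 * s * Real.cosh a - a * (n.natAbs : ℝ)) *
        (5 / (4 * Real.sqrt (1 + s)) + (Real.exp a - 1)) := by
  rcases hc with rfl | rfl
  · exact abs_G_succ_sub_le hs ha n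
  · have h := abs_G_succ_sub_le hs ha (-n)
    have e1 : G s (-n + 1) = G s (n + -1) := by
      unfold G; rw [show -n + 1 = -(n + -1) by ring, Int.natAbs_neg]
    have e2 : G s (-n) = G s n := by unfold G; rw [Int.natAbs_neg]
    rw [e1, e2, Int.natAbs_neg] at h
    exact h

end Tilt

/-- kernel: the common product Π_μ X_μ of the tilted one-dimensional bounds X_μ = (2/√(1+s))e^{2s cosh a_μ − a_μ|y_μ|} equals
(2/√(1+s))^d·exp(Σ_μ(2s cosh a_μ − a_μ|y_μ|)). [folklore] -/
private theorem prod_X_eq (s : ℝ) (y : ZSite d) (a : Fin d → ℝ) :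
    ∏ μ, 2 / Real.sqrt (1 + s) * Real.exp (2 * s * Real.cosh (a μ) - a μ * ((y μ).natAbs : ℝ)) =
      (2 / Real.sqrt (1 + s)) ^ d * Real.exp (∑ μ, (2 * s * Real.cosh (a μ) - a μ * ((y μ).natAbs : ℝ))) := by
  rw [Finset.prod_mul_distrib, Finset.prod_const, Finset.card_univ, Fintype.card_fin, Real.exp_sum]

/-- kernel: each undifferentiated factor is bounded by its tilted bound, |Π_{μ∈S}G(s,y_μ)| ≤ Π_{μ∈S}X_μ. [cite: Balaban1983Higgs3, (2.10) p.426] -/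
private theorem abs_prod_G_le {s : ℝ} (hs : 0 ≤ s) (y : ZSite d) (a : Fin d → ℝ) (ha : ∀ μ, 0 ≤ a μ) (S : Finset (Fin d)) :
    |∏ μ ∈ S, G s (y μ)| ≤ ∏ μ ∈ S, 2 / Real.sqrt (1 + s) * Real.exp (2 * s * Real.cosh (a μ) - a μ * ((y μ).natAbs : ℝ)) := by
  rw [Finset.abs_prod]
  refine Finset.prod_le_prod (fun μ _ => abs_nonneg _) fun μ _ => ?_
  rw [abs_of_nonneg (G_nonneg hs _)]
  exact besselF_le hs (ha μ) _

/-- **Tilted bound of the mixed second difference** (ν ≠ ν′, steps c, c′ ∈ {±1}, tilts a_μ ≥ 0):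
|Δ^{c′}_{ν′}Δ^{c}_νQ(s)(y)| ≤ (2/√(1+s))^d·exp(Σ_μ(2s cosh a_μ − a_μ|y_μ|))·(5/(4√(1+s)) + e^{a_ν} − 1)(5/(4√(1+s)) + e^{a_{ν′}} − 1).
[cite: Balaban1983Higgs3, (2.10) p.426] -/
theorem ddQ_mixed_le_tilt {s : ℝ} (hs : 0 ≤ s) (y : ZSite d) {ν ν' : Fin d} (hne : ν ≠ ν') {c c' : ℤ}
    (hc : c = 1 ∨ c = -1) (hc' : c' = 1 ∨ c' = -1) (a : Fin d → ℝ) (ha : ∀ μ, 0 ≤ a μ) :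
    |Q s (y + c • unitVec ν + c' • unitVec ν') - Q s (y + c • unitVec ν) - Q s (y + c' • unitVec ν') + Q s y| ≤
      (2 / Real.sqrt (1 + s)) ^ d * Real.exp (∑ μ, (2 * s * Real.cosh (a μ) - a μ * ((y μ).natAbs : ℝ))) *
        ((5 / (4 * Real.sqrt (1 + s)) + (Real.exp (a ν) - 1)) * (5 / (4 * Real.sqrt (1 + s)) + (Real.exp (a ν') - 1))) := by
  classical
  set X : Fin d → ℝ := fun μ => 2 / Real.sqrt (1 + s) * Real.exp (2 * s * Real.cosh (a μ) - a μ * ((y μ).natAbs : ℝ))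
    with hX
  have hXnn : ∀ μ, 0 ≤ X μ := fun μ => by positivity
  have hE : ∀ μ, 0 ≤ 5 / (4 * Real.sqrt (1 + s)) + (Real.exp (a μ) - 1) := fun μ => by
    have := Real.one_le_exp (ha μ)
    have : 0 ≤ 5 / (4 * Real.sqrt (1 + s)) := by positivity
    linarith
  rw [Q_mixedDiff s y hne, abs_mul, abs_mul]
  have hν : |G s (y ν + c) - G s (y ν)| ≤ X ν * (5 / (4 * Real.sqrt (1 + s)) + (Real.exp (a ν) - 1)) :=
    abs_G_step_sub_le hs (ha ν) (y ν) c hc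
  have hν' : |G s (y ν' + c') - G s (y ν')| ≤ X ν' * (5 / (4 * Real.sqrt (1 + s)) + (Real.exp (a ν') - 1)) :=
    abs_G_step_sub_le hs (ha ν') (y ν') c' hc'
  have hrest : |∏ μ ∈ (Finset.univ.erase ν).erase ν', G s (y μ)| ≤ ∏ μ ∈ (Finset.univ.erase ν).erase ν', X μ :=
    abs_prod_G_le hs y a ha _
  have hmem : ν' ∈ Finset.univ.erase ν := Finset.mem_erase.mpr ⟨hne.symm, Finset.mem_univ _⟩
  have hprod : X ν * (X ν' * ∏ μ ∈ (Finset.univ.erase ν).erase ν', X μ) = ∏ μ, X μ := by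
    rw [Finset.mul_prod_erase _ X hmem, Finset.mul_prod_erase _ X (Finset.mem_univ ν)]
  have hprod' : ∏ μ, X μ = (2 / Real.sqrt (1 + s)) ^ d *
      Real.exp (∑ μ, (2 * s * Real.cosh (a μ) - a μ * ((y μ).natAbs : ℝ))) := prod_X_eq s y a
  calc |G s (y ν + c) - G s (y ν)| * |G s (y ν' + c') - G s (y ν')| * |∏ μ ∈ (Finset.univ.erase ν).erase ν', G s (y μ)|
      ≤ (X ν * (5 / (4 * Real.sqrt (1 + s)) + (Real.exp (a ν) - 1))) *
          (X ν' * (5 / (4 * Real.sqrt (1 + s)) + (Real.exp (a ν') - 1))) * ∏ μ ∈ (Finset.univ.erase ν).erase ν', X μ :=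
        mul_le_mul (mul_le_mul hν hν' (abs_nonneg _) (mul_nonneg (hXnn ν) (hE ν))) hrest (abs_nonneg _)
          (mul_nonneg (mul_nonneg (hXnn ν) (hE ν)) (mul_nonneg (hXnn ν') (hE ν')))
    _ = (X ν * (X ν' * ∏ μ ∈ (Finset.univ.erase ν).erase ν', X μ)) *
          ((5 / (4 * Real.sqrt (1 + s)) + (Real.exp (a ν) - 1)) * (5 / (4 * Real.sqrt (1 + s)) + (Real.exp (a ν') - 1))) := by
        ring
    _ = _ := by rw [hprod, hprod']

/-- **Tilted bound of the pure second difference** (tilts a_μ ≥ 0; file 1's `abs_G_secondDiff_le` on the ν-factor):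
|Q(s)(y+e_ν) − 2Q(s)(y) + Q(s)(y−e_ν)| ≤ (2/√(1+s))^d·exp(Σ_μ(2s cosh a_μ − a_μ|y_μ|))·(10e^{a_ν}/(1+s) + (5/2)(e^{a_ν} − 1)/√(1+s) + 2(cosh a_ν − 1)).
[cite: Balaban1983Higgs3, (2.10) p.426] -/
theorem ddQ_pure_le_tilt {s : ℝ} (hs : 0 ≤ s) (y : ZSite d) (ν : Fin d) (a : Fin d → ℝ) (ha : ∀ μ, 0 ≤ a μ) :
    |Q s (y + unitVec ν) - 2 * Q s y + Q s (y - unitVec ν)| ≤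
      (2 / Real.sqrt (1 + s)) ^ d * Real.exp (∑ μ, (2 * s * Real.cosh (a μ) - a μ * ((y μ).natAbs : ℝ))) *
        (10 * Real.exp (a ν) / (1 + s) + 5 / 2 * (Real.exp (a ν) - 1) / Real.sqrt (1 + s) + 2 * (Real.cosh (a ν) - 1)) := by
  classical
  set X : Fin d → ℝ := fun μ => 2 / Real.sqrt (1 + s) * Real.exp (2 * s * Real.cosh (a μ) - a μ * ((y μ).natAbs : ℝ))
    with hX
  have hXnn : ∀ μ, 0 ≤ X μ := fun μ => by positivity
  have hE : 0 ≤ 10 * Real.exp (a ν) / (1 + s) + 5 / 2 * (Real.exp (a ν) - 1) / Real.sqrt (1 + s)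
      + 2 * (Real.cosh (a ν) - 1) := extra2_nonneg hs (ha ν)
  rw [Q_pureDiff s y ν, abs_mul]
  have hν : |G s (y ν + 1) - 2 * G s (y ν) + G s (y ν - 1)| ≤ X ν *
      (10 * Real.exp (a ν) / (1 + s) + 5 / 2 * (Real.exp (a ν) - 1) / Real.sqrt (1 + s) + 2 * (Real.cosh (a ν) - 1)) :=
    abs_G_secondDiff_le hs (ha ν) (y ν)
  have hrest : |∏ μ ∈ Finset.univ.erase ν, G s (y μ)| ≤ ∏ μ ∈ Finset.univ.erase ν, X μ := abs_prod_G_le hs y a ha _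
  have hprod : X ν * ∏ μ ∈ Finset.univ.erase ν, X μ = ∏ μ, X μ := Finset.mul_prod_erase _ X (Finset.mem_univ ν)
  have hprod' : ∏ μ, X μ = (2 / Real.sqrt (1 + s)) ^ d *
      Real.exp (∑ μ, (2 * s * Real.cosh (a μ) - a μ * ((y μ).natAbs : ℝ))) := prod_X_eq s y a
  calc |G s (y ν + 1) - 2 * G s (y ν) + G s (y ν - 1)| * |∏ μ ∈ Finset.univ.erase ν, G s (y μ)|
      ≤ (X ν * (10 * Real.exp (a ν) / (1 + s) + 5 / 2 * (Real.exp (a ν) - 1) / Real.sqrt (1 + s)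
          + 2 * (Real.cosh (a ν) - 1))) * ∏ μ ∈ Finset.univ.erase ν, X μ :=
        mul_le_mul hν hrest (abs_nonneg _) (mul_nonneg (hXnn ν) hE)
    _ = (X ν * ∏ μ ∈ Finset.univ.erase ν, X μ) * (10 * Real.exp (a ν) / (1 + s)
          + 5 / 2 * (Real.exp (a ν) - 1) / Real.sqrt (1 + s) + 2 * (Real.cosh (a ν) - 1)) := by ring
    _ = _ := by rw [hprod, hprod']

/-! ## 3. The two regimes (d = 3): Gaussian tilts a_μ = 5|y_μ|/(14s) if 5|y|_∞ ≤ 28s, the tilt 2 at a largest coordinate otherwise -/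

section Regimes

/-- kernel: e² ≤ 7.39. [folklore] -/
private theorem exp_two_le : Real.exp 2 ≤ 7.39 := by
  have he := Real.exp_one_lt_d9
  have h2 : Real.exp 2 = Real.exp 1 * Real.exp 1 := by rw [← Real.exp_add]; norm_num
  rw [h2]; nlinarith [Real.exp_pos 1]

/-- kernel: cosh 2 ≤ 19/5. [folklore] -/
private theorem cosh_two_le : Real.cosh 2 ≤ 19 / 5 := by
  rw [Real.cosh_eq]
  have he := Real.exp_one_lt_d9
  have he' := Real.exp_one_gt_d9
  have h2 : Real.exp 2 = Real.exp 1 * Real.exp 1 := by rw [← Real.exp_add]; norm_num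
  have hup : Real.exp 2 ≤ 7.3891 := by rw [h2]; nlinarith [Real.exp_pos 1]
  have hlo : 7.389 ≤ Real.exp 2 := by rw [h2]; nlinarith [Real.exp_pos 1]
  have hneg : Real.exp (-2) ≤ 0.1354 := by
    rw [Real.exp_neg, inv_le_comm₀ (Real.exp_pos 2) (by norm_num)]
    exact le_trans (by norm_num) hlo
  linarith

/-- kernel (chord of the convex exponential on [0,2]): e^a − 1 ≤ (16/5)·a for 0 ≤ a ≤ 2. [folklore] -/
private theorem exp_sub_one_le_chord {a : ℝ} (h0 : 0 ≤ a) (h2 : a ≤ 2) : Real.exp a - 1 ≤ 16 / 5 * a := by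
  have hconv := convexOn_exp.2 (Set.mem_univ (0 : ℝ)) (Set.mem_univ (2 : ℝ)) (by linarith : 0 ≤ 1 - a / 2)
    (by linarith : 0 ≤ a / 2) (by ring)
  simp only [smul_eq_mul, mul_zero, zero_add, Real.exp_zero, mul_one] at hconv
  have h : (a / 2) * 2 = a := by ring
  rw [h] at hconv
  nlinarith [exp_two_le]

/-- kernel: cosh a − 1 ≤ (8/5)a² for 0 ≤ a ≤ 2 (cosh a ≤ e^{a²/2}, Mathlib's `Real.cosh_le_exp_half_sq`, and the chord with
a²/2 ∈ [0,2]). [folklore] -/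
private theorem cosh_sub_one_le {a : ℝ} (h0 : 0 ≤ a) (h2 : a ≤ 2) : Real.cosh a - 1 ≤ 8 / 5 * a ^ 2 := by
  have h1 := Real.cosh_le_exp_half_sq a
  have ha2 : a ^ 2 / 2 ≤ 2 := by nlinarith
  have h3 := exp_sub_one_le_chord (by positivity : 0 ≤ a ^ 2 / 2) ha2
  linarith

/-- kernel (THE TWO REGIMES, shared by the mixed and the pure second difference): if a quantity D obeys the tilted bound
|D| ≤ (2/√(1+s))³·exp(Σ_μ(2s cosh a_μ − a_μ|y_μ|))·Φ(a) for all tilts a ≥ 0 with an extra factor Φ(a) ≥ 0 that is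
≤ 74/(1+s) + (20/7)N/(s√(1+s)) + (64/49)N²/s² at the Gaussian tilts (when 5N ≤ 28s) and ≤ 96 at the tilt 2·[μ = μ₀] (N = |y_{μ₀}| = |y|_∞),
then |D| ≤ (2/√(1+s))³·[e^{6s − (5/28)R²/s}(74/(1+s) + (20/7)N/(s√(1+s)) + (64/49)N²/s²) + 96·e^{6s − N}] (`sum_tilt_gauss`, `sum_tilt_max`).
[cite: Balaban1983Higgs3, (2.10) p.426] -/
theorem two_regime_bound {s : ℝ} (hs : 0 < s) (y : ZSite 3) (μ₀ : Fin 3) (hmax : ∀ μ, (y μ).natAbs ≤ (y μ₀).natAbs)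
    {D : ℝ} {Φ : (Fin 3 → ℝ) → ℝ}
    (hD : ∀ a : Fin 3 → ℝ, (∀ μ, 0 ≤ a μ) → 0 ≤ Φ a ∧ |D| ≤ (2 / Real.sqrt (1 + s)) ^ 3 *
        Real.exp (∑ μ, (2 * s * Real.cosh (a μ) - a μ * ((y μ).natAbs : ℝ))) * Φ a)
    (hΦg : (∀ μ, 5 * ((y μ).natAbs : ℝ) ≤ 28 * s) →
        Φ (fun μ => 5 * ((y μ).natAbs : ℝ) / (14 * s)) ≤
          74 / (1 + s) + 20 / 7 * ((y μ₀).natAbs : ℝ) / (s * Real.sqrt (1 + s))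
            + 64 / 49 * ((y μ₀).natAbs : ℝ) ^ 2 / s ^ 2)
    (hΦl : Φ (fun μ => if μ = μ₀ then 2 else 0) ≤ 96) :
    |D| ≤ (2 / Real.sqrt (1 + s)) ^ 3 *
      (Real.exp (6 * s - 5 / 28 * rsq y / s) *
          (74 / (1 + s) + 20 / 7 * ((y μ₀).natAbs : ℝ) / (s * Real.sqrt (1 + s))
            + 64 / 49 * ((y μ₀).natAbs : ℝ) ^ 2 / s ^ 2)
        + 96 * Real.exp (6 * s - ((y μ₀).natAbs : ℝ))) := by
  have hpref : 0 ≤ (2 / Real.sqrt (1 + s)) ^ 3 := by positivity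
  have h1s : 0 < 1 + s := by linarith
  have hbrk0 : 0 ≤ 74 / (1 + s) + 20 / 7 * ((y μ₀).natAbs : ℝ) / (s * Real.sqrt (1 + s))
      + 64 / 49 * ((y μ₀).natAbs : ℝ) ^ 2 / s ^ 2 := by positivity
  have hA0 : 0 ≤ Real.exp (6 * s - 5 / 28 * rsq y / s) *
      (74 / (1 + s) + 20 / 7 * ((y μ₀).natAbs : ℝ) / (s * Real.sqrt (1 + s))
        + 64 / 49 * ((y μ₀).natAbs : ℝ) ^ 2 / s ^ 2) := by positivity
  have hB0 : 0 ≤ 96 * Real.exp (6 * s - ((y μ₀).natAbs : ℝ)) := by positivity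
  rcases le_or_gt (5 * ((y μ₀).natAbs : ℝ)) (28 * s) with h1 | h2
  · -- Gaussian regime
    have hall : ∀ μ, 5 * ((y μ).natAbs : ℝ) ≤ 28 * s := fun μ => by
      have : ((y μ).natAbs : ℝ) ≤ ((y μ₀).natAbs : ℝ) := by exact_mod_cast hmax μ
      linarith
    obtain ⟨hΦ0, hQ⟩ := hD (fun μ => 5 * ((y μ).natAbs : ℝ) / (14 * s)) (fun μ => by positivity)
    have hE := sum_tilt_gauss hs y hall
    push_cast at hE
    calc |D| ≤ _ := hQ
      _ ≤ (2 / Real.sqrt (1 + s)) ^ 3 * (Real.exp (6 * s - 5 / 28 * rsq y / s) *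
            (74 / (1 + s) + 20 / 7 * ((y μ₀).natAbs : ℝ) / (s * Real.sqrt (1 + s))
              + 64 / 49 * ((y μ₀).natAbs : ℝ) ^ 2 / s ^ 2)) := by
          rw [mul_assoc]
          refine mul_le_mul_of_nonneg_left ?_ hpref
          exact mul_le_mul (Real.exp_le_exp.mpr (by linarith)) (hΦg hall) hΦ0 (Real.exp_pos _).le
      _ ≤ _ := by
          refine mul_le_mul_of_nonneg_left ?_ hpref
          linarith
  · -- large-coordinate regime
    obtain ⟨hΦ0, hQ⟩ := hD (fun μ => if μ = μ₀ then 2 else 0) (fun μ => by split_ifs <;> norm_num)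
    have hE := sum_tilt_max hs.le y μ₀ h2
    push_cast at hE
    calc |D| ≤ _ := hQ
      _ ≤ (2 / Real.sqrt (1 + s)) ^ 3 * (Real.exp (6 * s - ((y μ₀).natAbs : ℝ)) * 96) := by
          rw [mul_assoc]
          refine mul_le_mul_of_nonneg_left ?_ hpref
          exact mul_le_mul (Real.exp_le_exp.mpr (by linarith)) hΦl hΦ0 (Real.exp_pos _).le
      _ ≤ _ := by
          refine mul_le_mul_of_nonneg_left ?_ hpref
          linarith

/-- **Both regimes, mixed second difference (d = 3)**: for s > 0, y ∈ ℤ³, μ₀ a largest coordinate, ν ≠ ν′, steps c, c′ ∈ {±1},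
|Δ^{c′}_{ν′}Δ^{c}_νQ(s)(y)| ≤ (2/√(1+s))³·[e^{6s − (5/28)R²(y)/s}(74/(1+s) + (20/7)|y_{μ₀}|/(s√(1+s)) + (64/49)|y_{μ₀}|²/s²) + 96·e^{6s − |y_{μ₀}|}]
(Gaussian regime: each extra factor ≤ 5/(4√(1+s)) + (8/7)|y_{μ₀}|/s, squared; large regime: each ≤ 5/4 + e² − 1 ≤ 8).
[cite: Balaban1983Higgs3, (2.10) p.426] -/
theorem ddQ_mixed_three_le {s : ℝ} (hs : 0 < s) (y : ZSite 3) {ν ν' : Fin 3} (hne : ν ≠ ν') {c c' : ℤ}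
    (hc : c = 1 ∨ c = -1) (hc' : c' = 1 ∨ c' = -1) (μ₀ : Fin 3) (hmax : ∀ μ, (y μ).natAbs ≤ (y μ₀).natAbs) :
    |Q s (y + c • unitVec ν + c' • unitVec ν') - Q s (y + c • unitVec ν) - Q s (y + c' • unitVec ν') + Q s y| ≤
      (2 / Real.sqrt (1 + s)) ^ 3 *
        (Real.exp (6 * s - 5 / 28 * rsq y / s) *
            (74 / (1 + s) + 20 / 7 * ((y μ₀).natAbs : ℝ) / (s * Real.sqrt (1 + s))
              + 64 / 49 * ((y μ₀).natAbs : ℝ) ^ 2 / s ^ 2)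
          + 96 * Real.exp (6 * s - ((y μ₀).natAbs : ℝ))) := by
  have h1s : 0 < 1 + s := by linarith
  have hsq1 : 1 ≤ Real.sqrt (1 + s) := by
    calc (1 : ℝ) = Real.sqrt 1 := Real.sqrt_one.symm
      _ ≤ Real.sqrt (1 + s) := Real.sqrt_le_sqrt (by linarith)
  have hsq : 0 < Real.sqrt (1 + s) := by linarith
  have hsq2 : Real.sqrt (1 + s) ^ 2 = 1 + s := Real.sq_sqrt h1s.le
  have h54 : 0 ≤ 5 / (4 * Real.sqrt (1 + s)) := by positivity
  have hE0 : ∀ b : ℝ, 0 ≤ b → 0 ≤ 5 / (4 * Real.sqrt (1 + s)) + (Real.exp b - 1) := fun b hb => by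
    have := Real.one_le_exp hb; linarith
  refine two_regime_bound hs y μ₀ hmax
    (Φ := fun a => (5 / (4 * Real.sqrt (1 + s)) + (Real.exp (a ν) - 1)) * (5 / (4 * Real.sqrt (1 + s)) + (Real.exp (a ν') - 1)))
    (fun a ha => ⟨mul_nonneg (hE0 _ (ha ν)) (hE0 _ (ha ν')), ddQ_mixed_le_tilt hs.le y hne hc hc' a ha⟩) ?_ ?_
  · -- Gaussian regime
    intro hall
    set N : ℝ := ((y μ₀).natAbs : ℝ) with hN
    set w := Real.sqrt (1 + s) with hw
    have hb : ∀ κ : Fin 3, 5 / (4 * w) + (Real.exp (5 * ((y κ).natAbs : ℝ) / (14 * s)) - 1) ≤ 5 / (4 * w) + 8 / 7 * N / s := by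
      intro κ
      have hκ : ((y κ).natAbs : ℝ) ≤ N := by rw [hN]; exact_mod_cast hmax κ
      have ha2 : 5 * ((y κ).natAbs : ℝ) / (14 * s) ≤ 2 := by
        rw [div_le_iff₀ (by positivity)]; linarith [hall κ]
      have hchord := exp_sub_one_le_chord (by positivity : 0 ≤ 5 * ((y κ).natAbs : ℝ) / (14 * s)) ha2
      have e : 16 / 5 * (5 * ((y κ).natAbs : ℝ) / (14 * s)) = 8 / 7 * ((y κ).natAbs : ℝ) / s := by
        field_simp; ring
      have hmono : 8 / 7 * ((y κ).natAbs : ℝ) / s ≤ 8 / 7 * N / s := div_le_div_of_nonneg_right (by linarith) hs.le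
      linarith
    have hsq' : (5 / (4 * w) + 8 / 7 * N / s) ^ 2 = 25 / 16 / (1 + s) + 20 / 7 * N / (s * w) + 64 / 49 * N ^ 2 / s ^ 2 := by
      rw [← hsq2]; field_simp; ring
    have h25 : 25 / 16 / (1 + s) ≤ 74 / (1 + s) := div_le_div_of_nonneg_right (by norm_num) h1s.le
    calc (5 / (4 * w) + (Real.exp (5 * ((y ν).natAbs : ℝ) / (14 * s)) - 1)) *
          (5 / (4 * w) + (Real.exp (5 * ((y ν').natAbs : ℝ) / (14 * s)) - 1))
        ≤ (5 / (4 * w) + 8 / 7 * N / s) * (5 / (4 * w) + 8 / 7 * N / s) :=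
          mul_le_mul (hb ν) (hb ν') (hE0 _ (by positivity)) (by positivity)
      _ = (5 / (4 * w) + 8 / 7 * N / s) ^ 2 := by ring
      _ ≤ _ := by rw [hsq']; linarith
  · -- large-coordinate regime
    have hextra : ∀ κ : Fin 3, 5 / (4 * Real.sqrt (1 + s)) + (Real.exp (if κ = μ₀ then 2 else 0) - 1) ≤ 8 := by
      intro κ
      have h54' : 5 / (4 * Real.sqrt (1 + s)) ≤ 5 / 4 := by
        rw [div_le_div_iff_of_pos_left (by norm_num) (by positivity) (by norm_num)]; linarith
      have : Real.exp (if κ = μ₀ then 2 else 0) ≤ Real.exp 2 := Real.exp_le_exp.mpr (by split_ifs <;> norm_num)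
      linarith [exp_two_le]
    calc (5 / (4 * Real.sqrt (1 + s)) + (Real.exp (if ν = μ₀ then 2 else 0) - 1)) *
          (5 / (4 * Real.sqrt (1 + s)) + (Real.exp (if ν' = μ₀ then 2 else 0) - 1)) ≤ 8 * 8 :=
          mul_le_mul (hextra ν) (hextra ν') (hE0 _ (by split_ifs <;> norm_num)) (by norm_num)
      _ ≤ 96 := by norm_num

/-- **Both regimes, pure second difference (d = 3)**: for s > 0, y ∈ ℤ³, μ₀ a largest coordinate and any direction ν,
|Q(s)(y+e_ν) − 2Q(s)(y) + Q(s)(y−e_ν)| ≤ (2/√(1+s))³·[e^{6s − (5/28)R²(y)/s}(74/(1+s) + (20/7)|y_{μ₀}|/(s√(1+s)) + (64/49)|y_{μ₀}|²/s²) + 96·e^{6s − |y_{μ₀}|}]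
(Gaussian regime: e^a ≤ e² ≤ 7.39, (5/2)(e^a − 1) ≤ 8a, 2(cosh a − 1) ≤ (16/5)a² with a = 5|y_ν|/(14s); large regime:
10e² + (5/2)(e² − 1) + 2(cosh 2 − 1) ≤ 96). [cite: Balaban1983Higgs3, (2.10) p.426] -/
theorem ddQ_pure_three_le {s : ℝ} (hs : 0 < s) (y : ZSite 3) (ν : Fin 3) (μ₀ : Fin 3)
    (hmax : ∀ μ, (y μ).natAbs ≤ (y μ₀).natAbs) :
    |Q s (y + unitVec ν) - 2 * Q s y + Q s (y - unitVec ν)| ≤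
      (2 / Real.sqrt (1 + s)) ^ 3 *
        (Real.exp (6 * s - 5 / 28 * rsq y / s) *
            (74 / (1 + s) + 20 / 7 * ((y μ₀).natAbs : ℝ) / (s * Real.sqrt (1 + s))
              + 64 / 49 * ((y μ₀).natAbs : ℝ) ^ 2 / s ^ 2)
          + 96 * Real.exp (6 * s - ((y μ₀).natAbs : ℝ))) := by
  have h1s : 0 < 1 + s := by linarith
  have hsq1 : 1 ≤ Real.sqrt (1 + s) := by
    calc (1 : ℝ) = Real.sqrt 1 := Real.sqrt_one.symm
      _ ≤ Real.sqrt (1 + s) := Real.sqrt_le_sqrt (by linarith)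
  have hsq : 0 < Real.sqrt (1 + s) := by linarith
  refine two_regime_bound hs y μ₀ hmax
    (Φ := fun a => 10 * Real.exp (a ν) / (1 + s) + 5 / 2 * (Real.exp (a ν) - 1) / Real.sqrt (1 + s)
      + 2 * (Real.cosh (a ν) - 1))
    (fun a ha => ⟨extra2_nonneg hs.le (ha ν), ddQ_pure_le_tilt hs.le y ν a ha⟩) ?_ ?_
  · -- Gaussian regime
    intro hall
    set N : ℝ := ((y μ₀).natAbs : ℝ) with hN
    set n : ℝ := ((y ν).natAbs : ℝ) with hn
    set w := Real.sqrt (1 + s) with hw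
    set b : ℝ := 5 * n / (14 * s) with hb
    have hn0 : 0 ≤ n := Nat.cast_nonneg _
    have hnN : n ≤ N := by rw [hn, hN]; exact_mod_cast hmax ν
    have hb0 : 0 ≤ b := by positivity
    have hb2 : b ≤ 2 := by rw [hb, div_le_iff₀ (by positivity)]; linarith [hall ν]
    -- term 1
    have h1 : 10 * Real.exp b / (1 + s) ≤ 74 / (1 + s) := by
      refine div_le_div_of_nonneg_right ?_ h1s.le
      have := Real.exp_le_exp.mpr hb2
      linarith [exp_two_le]
    -- term 2
    have h2 : 5 / 2 * (Real.exp b - 1) / w ≤ 20 / 7 * N / (s * w) := by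
      have hchord := exp_sub_one_le_chord hb0 hb2
      have e : 5 / 2 * (16 / 5 * b) / w = 20 / 7 * n / (s * w) := by
        rw [hb]; field_simp; ring
      calc 5 / 2 * (Real.exp b - 1) / w ≤ 5 / 2 * (16 / 5 * b) / w :=
            div_le_div_of_nonneg_right (by linarith) hsq.le
        _ = 20 / 7 * n / (s * w) := e
        _ ≤ 20 / 7 * N / (s * w) := by
            refine div_le_div_of_nonneg_right ?_ (by positivity)
            linarith
    -- term 3
    have h3 : 2 * (Real.cosh b - 1) ≤ 64 / 49 * N ^ 2 / s ^ 2 := by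
      have hc := cosh_sub_one_le hb0 hb2
      have e : 2 * (8 / 5 * b ^ 2) = 20 / 49 * n ^ 2 / s ^ 2 := by
        rw [hb]; field_simp; ring
      have hmono : 20 / 49 * n ^ 2 / s ^ 2 ≤ 64 / 49 * N ^ 2 / s ^ 2 := by
        refine div_le_div_of_nonneg_right ?_ (by positivity)
        nlinarith
      linarith
    linarith
  · -- large-coordinate regime
    have h74 : 10 * Real.exp 2 / (1 + s) ≤ 10 * Real.exp 2 :=
      div_le_self (by positivity) (by linarith)
    have h16 : 5 / 2 * (Real.exp 2 - 1) / Real.sqrt (1 + s) ≤ 5 / 2 * (Real.exp 2 - 1) :=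
      div_le_self (by linarith [Real.one_le_exp (show (0:ℝ) ≤ 2 by norm_num)]) hsq1
    have h10 : 10 * Real.exp 0 / (1 + s) ≤ 10 * Real.exp 0 :=
      div_le_self (by positivity) (by linarith)
    show 10 * Real.exp (if ν = μ₀ then (2 : ℝ) else 0) / (1 + s)
        + 5 / 2 * (Real.exp (if ν = μ₀ then (2 : ℝ) else 0) - 1) / Real.sqrt (1 + s)
        + 2 * (Real.cosh (if ν = μ₀ then (2 : ℝ) else 0) - 1) ≤ 96
    split_ifs
    · linarith [exp_two_le, cosh_two_le]
    · simp only [Real.exp_zero, Real.cosh_zero, sub_self, mul_zero, zero_div, add_zero] at h10 ⊢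
      linarith

end Regimes

/-! ## 4. Pointwise bounds for the second differences of the Poissonized integrands on ξℤ³ -/

section Integrand

/-- kernel: θ = (6+ξ²)^{−1} > 0. [folklore] -/
private theorem theta3_pos (hξ : 0 < ξ) : 0 < hopWeight 3 ξ := by
  unfold hopWeight; positivity

/-- kernel: 6θ = 1 − θξ² for θ = (6+ξ²)^{−1}. [folklore] -/
private theorem six_theta3 (hξ : 0 < ξ) : 6 * hopWeight 3 ξ = 1 - hopWeight 3 ξ * ξ ^ 2 := by
  have h : hopWeight 3 ξ * (2 * ((3 : ℕ) : ℝ) + ξ ^ 2) = 1 := by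
    unfold hopWeight; exact inv_mul_cancel₀ (by positivity)
  push_cast at h
  linarith

/-- kernel (completing the square): x R/2 + R²/(14u) ≤ x²u + (5/28)R²/u for u > 0. [folklore] -/
private theorem complete_square {u x R : ℝ} (hu : 0 < u) :
    x * R / 2 + R ^ 2 / (14 * u) ≤ x ^ 2 * u + 5 / 28 * R ^ 2 / u := by
  have hu' := hu.ne'
  have e : x ^ 2 * u + 5 / 28 * R ^ 2 / u - (x * R / 2 + R ^ 2 / (14 * u))
      = ((x * u - R / 4) ^ 2 + 5 / 112 * R ^ 2) / u := by
    field_simp; ring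
  have : 0 ≤ x ^ 2 * u + 5 / 28 * R ^ 2 / u - (x * R / 2 + R ^ 2 / (14 * u)) := by
    rw [e]; positivity
  linarith

/-- kernel: (2/√(1+u))³ ≤ 8u^{−3/2} for u > 0. [folklore] -/
private theorem pref_le_rpow {u : ℝ} (hu : 0 < u) : (2 / Real.sqrt (1 + u)) ^ 3 ≤ 8 * u ^ (-(3 / 2 : ℝ)) := by
  have hsu : 0 < Real.sqrt u := Real.sqrt_pos.mpr hu
  have hle : Real.sqrt u ≤ Real.sqrt (1 + u) := Real.sqrt_le_sqrt (by linarith)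
  have h1 : 2 / Real.sqrt (1 + u) ≤ 2 / Real.sqrt u := div_le_div_of_nonneg_left (by norm_num) hsu hle
  have h1' : (2 / Real.sqrt (1 + u)) ^ 3 ≤ (2 / Real.sqrt u) ^ 3 := pow_le_pow_left₀ (by positivity) h1 3
  have h2 : (2 / Real.sqrt u) ^ 3 = 8 * u ^ (-(3 / 2 : ℝ)) := by
    rw [div_pow, Real.rpow_neg hu.le, Real.sqrt_eq_rpow, ← Real.rpow_natCast (u ^ (1 / (2 : ℝ))) 3,
      ← Real.rpow_mul hu.le]
    norm_num [div_eq_mul_inv]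
  linarith [h2.le]

/-- kernel: (2/√(1+u))³·(c/(1+u)) ≤ 8c·u^{−5/2} for u > 0, c ≥ 0. [folklore] -/
private theorem prefA {u c : ℝ} (hu : 0 < u) (hc : 0 ≤ c) :
    (2 / Real.sqrt (1 + u)) ^ 3 * (c / (1 + u)) ≤ 8 * c * u ^ (-(5 / 2 : ℝ)) := by
  have hp := pref_le_rpow hu
  have e : u ^ (-(5 / 2 : ℝ)) = u ^ (-(3 / 2 : ℝ)) * u⁻¹ := by
    rw [← Real.rpow_neg_one, ← Real.rpow_add hu]; norm_num
  have hcu : c / (1 + u) ≤ c * u⁻¹ := by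
    rw [← div_eq_mul_inv]; exact div_le_div_of_nonneg_left hc hu (by linarith)
  rw [e]
  calc (2 / Real.sqrt (1 + u)) ^ 3 * (c / (1 + u)) ≤ 8 * u ^ (-(3 / 2 : ℝ)) * (c * u⁻¹) :=
        mul_le_mul hp hcu (by positivity) (by positivity)
    _ = 8 * c * (u ^ (-(3 / 2 : ℝ)) * u⁻¹) := by ring

/-- kernel: (2/√(1+u))³·(c/(u√(1+u))) ≤ 8c·u^{−3} for u > 0, c ≥ 0 ((2/√(1+u))⁴/2 = 8/(1+u)² ≤ 8/u²). [folklore] -/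
private theorem prefB {u c : ℝ} (hu : 0 < u) (hc : 0 ≤ c) :
    (2 / Real.sqrt (1 + u)) ^ 3 * (c / (u * Real.sqrt (1 + u))) ≤ 8 * c * u ^ (-(3 : ℝ)) := by
  have h1u : 0 < 1 + u := by linarith
  have hsq : 0 < Real.sqrt (1 + u) := Real.sqrt_pos.mpr h1u
  have hsq2 : Real.sqrt (1 + u) ^ 2 = 1 + u := Real.sq_sqrt h1u.le
  set w := Real.sqrt (1 + u) with hw
  have hw4 : (1 + u) ^ 2 = w ^ 4 := by rw [← hsq2]; ring
  have e1 : (2 / w) ^ 3 * (c / (u * w)) = 8 * c / ((1 + u) ^ 2 * u) := by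
    rw [hw4]; field_simp; ring
  have e2 : (8 : ℝ) * c * u ^ (-(3 : ℝ)) = 8 * c / (u ^ 2 * u) := by
    rw [Real.rpow_neg hu.le, show (3 : ℝ) = ((3 : ℕ) : ℝ) by norm_num, Real.rpow_natCast]; field_simp
  rw [e1, e2]
  have hu2 : u ^ 2 * u ≤ (1 + u) ^ 2 * u := by nlinarith [mul_pos hu hu]
  exact div_le_div_of_nonneg_left (by positivity) (by positivity) hu2

/-- kernel: (2/√(1+u))³·(c/u²) ≤ 8c·u^{−7/2} for u > 0, c ≥ 0. [folklore] -/
private theorem prefC {u c : ℝ} (hu : 0 < u) (hc : 0 ≤ c) :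
    (2 / Real.sqrt (1 + u)) ^ 3 * (c / u ^ 2) ≤ 8 * c * u ^ (-(7 / 2 : ℝ)) := by
  have hp := pref_le_rpow hu
  have e : u ^ (-(7 / 2 : ℝ)) = u ^ (-(3 / 2 : ℝ)) * (u ^ 2)⁻¹ := by
    rw [← Real.rpow_two, ← Real.rpow_neg hu.le, ← Real.rpow_add hu]; norm_num
  rw [e, div_eq_mul_inv c]
  calc (2 / Real.sqrt (1 + u)) ^ 3 * (c * (u ^ 2)⁻¹) ≤ 8 * u ^ (-(3 / 2 : ℝ)) * (c * (u ^ 2)⁻¹) :=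
        mul_le_mul_of_nonneg_right hp (by positivity)
    _ = 8 * c * (u ^ (-(3 / 2 : ℝ)) * (u ^ 2)⁻¹) := by ring

/-- kernel (FROM THE TWO-REGIME KERNEL BOUND TO THE INTEGRAND BOUND): if at s = θt (t > 0, θ = (6+ξ²)^{−1}, R² = Σ_μy_μ², N = |y|_∞)
|D| ≤ (2/√(1+s))³·[e^{6s − (5/28)R²/s}(74/(1+s) + (20/7)N/(s√(1+s)) + (64/49)N²/s²) + 96e^{6s − N}], then
e^{−t}|D| ≤ e^{−ξR/2}·[592(θt)^{−5/2} + (160/7)N(θt)^{−3} + (512/49)N²(θt)^{−7/2}]e^{−(R²/14)/(θt)} + 96e^{−N}(2/√(1+θt))³ —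
e^{−t+6θt} = e^{−ξ²θt}, ξ²u + (5/28)R²/u ≥ ξR/2 + R²/(14u), and the three prefactor bounds. [cite: Balaban1983Higgs3, (2.10) p.426] -/
theorem integrand_bound_of_ddQ (hξ : 0 < ξ) (y : ZSite 3) (μ₀ : Fin 3) {t : ℝ} (ht : 0 < t) {D : ℝ}
    (hD : |D| ≤ (2 / Real.sqrt (1 + hopWeight 3 ξ * t)) ^ 3 *
      (Real.exp (6 * (hopWeight 3 ξ * t) - 5 / 28 * rsq y / (hopWeight 3 ξ * t)) *
          (74 / (1 + hopWeight 3 ξ * t)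
            + 20 / 7 * ((y μ₀).natAbs : ℝ) / ((hopWeight 3 ξ * t) * Real.sqrt (1 + hopWeight 3 ξ * t))
            + 64 / 49 * ((y μ₀).natAbs : ℝ) ^ 2 / (hopWeight 3 ξ * t) ^ 2)
        + 96 * Real.exp (6 * (hopWeight 3 ξ * t) - ((y μ₀).natAbs : ℝ)))) :
    Real.exp (-t) * |D| ≤
      Real.exp (-(ξ * Real.sqrt (rsq y) / 2)) *
          ((592 * (hopWeight 3 ξ * t) ^ (-(5 / 2 : ℝ))
              + 160 / 7 * ((y μ₀).natAbs : ℝ) * (hopWeight 3 ξ * t) ^ (-(3 : ℝ))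
              + 512 / 49 * ((y μ₀).natAbs : ℝ) ^ 2 * (hopWeight 3 ξ * t) ^ (-(7 / 2 : ℝ)))
            * Real.exp (-(rsq y / 14) / (hopWeight 3 ξ * t)))
        + 96 * Real.exp (-((y μ₀).natAbs : ℝ)) * (2 / Real.sqrt (1 + hopWeight 3 ξ * t)) ^ 3 := by
  have hθ : 0 < hopWeight 3 ξ := theta3_pos hξ
  have h6 := six_theta3 hξ
  have hs : 0 < hopWeight 3 ξ * t := mul_pos hθ ht
  have hR2 : Real.sqrt (rsq y) ^ 2 = rsq y := Real.sq_sqrt (rsq_nonneg y)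
  have hcs := complete_square (x := ξ) (R := Real.sqrt (rsq y)) hs
  rw [hR2] at hcs
  set s := hopWeight 3 ξ * t with hsdef
  set R := Real.sqrt (rsq y) with hRdef
  set N : ℝ := ((y μ₀).natAbs : ℝ) with hNdef
  have hN : 0 ≤ N := Nat.cast_nonneg _
  have hpA := prefA hs (show (0 : ℝ) ≤ 74 by norm_num)
  have hpB := prefB hs (show (0 : ℝ) ≤ 20 / 7 * N by positivity)
  have hpC := prefC hs (show (0 : ℝ) ≤ 64 / 49 * N ^ 2 by positivity)
  have hexp : -t + 6 * s = -(ξ ^ 2 * s) := by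
    rw [hsdef]
    have : -t + 6 * (hopWeight 3 ξ * t) = -((1 - 6 * hopWeight 3 ξ) * t) := by ring
    rw [this, h6]; ring
  have hpref : 0 ≤ (2 / Real.sqrt (1 + s)) ^ 3 := by positivity
  set P := (2 / Real.sqrt (1 + s)) ^ 3 with hPdef
  set Eq : ℝ := Real.exp (-(rsq y / 14) / s) with hEq
  have hEq0 : 0 < Eq := Real.exp_pos _
  set brk : ℝ := 74 / (1 + s) + 20 / 7 * N / (s * Real.sqrt (1 + s)) + 64 / 49 * N ^ 2 / s ^ 2 with hbrk
  have hbrk0 : 0 ≤ brk := by positivity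
  -- step 1: absorb e^{−t}
  have step1 : Real.exp (-t) * |D| ≤
      P * (Real.exp (-(ξ ^ 2 * s) - 5 / 28 * rsq y / s) * brk + 96 * Real.exp (-(ξ ^ 2 * s) - N)) := by
    calc Real.exp (-t) * |D|
        ≤ Real.exp (-t) * (P * (Real.exp (6 * s - 5 / 28 * rsq y / s) * brk + 96 * Real.exp (6 * s - N))) :=
          mul_le_mul_of_nonneg_left hD (Real.exp_pos _).le
      _ = _ := by
          have e1 : Real.exp (-t) * Real.exp (6 * s - 5 / 28 * rsq y / s) = Real.exp (-(ξ ^ 2 * s) - 5 / 28 * rsq y / s) := by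
            rw [← Real.exp_add]; congr 1; linarith
          have e2 : Real.exp (-t) * Real.exp (6 * s - N) = Real.exp (-(ξ ^ 2 * s) - N) := by
            rw [← Real.exp_add]; congr 1; linarith
          rw [← e1, ← e2]; ring
  -- step 2: complete the square and drop e^{−ξ²s} in the second term
  have hgauss : Real.exp (-(ξ ^ 2 * s) - 5 / 28 * rsq y / s) ≤ Real.exp (-(ξ * R / 2)) * Eq := by
    rw [hEq, ← Real.exp_add]
    refine Real.exp_le_exp.mpr ?_
    have e3 : -(rsq y / 14) / s = -(rsq y / (14 * s)) := by rw [neg_div, div_div]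
    rw [e3]
    linarith
  have hmax' : Real.exp (-(ξ ^ 2 * s) - N) ≤ Real.exp (-N) :=
    Real.exp_le_exp.mpr (by linarith [mul_nonneg (sq_nonneg ξ) hs.le])
  have step2 : P * (Real.exp (-(ξ ^ 2 * s) - 5 / 28 * rsq y / s) * brk + 96 * Real.exp (-(ξ ^ 2 * s) - N))
      ≤ Real.exp (-(ξ * R / 2)) * (Eq * (P * brk)) + 96 * Real.exp (-N) * P := by
    have h1 : P * (Real.exp (-(ξ ^ 2 * s) - 5 / 28 * rsq y / s) * brk) ≤ P * ((Real.exp (-(ξ * R / 2)) * Eq) * brk) :=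
      mul_le_mul_of_nonneg_left (mul_le_mul_of_nonneg_right hgauss hbrk0) hpref
    have h2 : P * (96 * Real.exp (-(ξ ^ 2 * s) - N)) ≤ P * (96 * Real.exp (-N)) :=
      mul_le_mul_of_nonneg_left (by linarith) hpref
    have e : P * ((Real.exp (-(ξ * R / 2)) * Eq) * brk) + P * (96 * Real.exp (-N))
        = Real.exp (-(ξ * R / 2)) * (Eq * (P * brk)) + 96 * Real.exp (-N) * P := by ring
    rw [mul_add, ← e]
    exact add_le_add h1 h2
  -- step 3: the prefactor bounds
  have step3 : Eq * (P * brk) ≤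
      (592 * s ^ (-(5 / 2 : ℝ)) + 160 / 7 * N * s ^ (-(3 : ℝ)) + 512 / 49 * N ^ 2 * s ^ (-(7 / 2 : ℝ))) * Eq := by
    have h : P * brk ≤ 592 * s ^ (-(5 / 2 : ℝ)) + 160 / 7 * N * s ^ (-(3 : ℝ)) + 512 / 49 * N ^ 2 * s ^ (-(7 / 2 : ℝ)) := by
      have hsum := add_le_add (add_le_add hpA hpB) hpC
      have e : P * brk = P * (74 / (1 + s)) + P * (20 / 7 * N / (s * Real.sqrt (1 + s))) + P * (64 / 49 * N ^ 2 / s ^ 2) := by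
        rw [hbrk]; ring
      rw [e]
      refine hsum.trans (le_of_eq ?_)
      ring
    calc Eq * (P * brk) = (P * brk) * Eq := mul_comm _ _
      _ ≤ _ := mul_le_mul_of_nonneg_right h hEq0.le
  have hE1 : 0 ≤ Real.exp (-(ξ * R / 2)) := (Real.exp_pos _).le
  calc Real.exp (-t) * |D| ≤ _ := step1
    _ ≤ _ := step2
    _ ≤ _ := by
        have := mul_le_mul_of_nonneg_left step3 hE1
        linarith

/-- kernel: the mixed second difference of the integrands is e^{−t}·Δ^{c′}_{ν′}Δ^{c}_νQ(θt)(y). [cite: Balaban1983Higgs3, (2.10) p.426] -/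
theorem integrand_mixedDiff (ξ : ℝ) (y : ZSite d) (ν ν' : Fin d) (c c' : ℤ) (t : ℝ) :
    integrand d ξ (y + c • unitVec ν + c' • unitVec ν') t - integrand d ξ (y + c • unitVec ν) t
        - integrand d ξ (y + c' • unitVec ν') t + integrand d ξ y t =
      Real.exp (-t) * (Q (hopWeight d ξ * t) (y + c • unitVec ν + c' • unitVec ν') - Q (hopWeight d ξ * t) (y + c • unitVec ν)
        - Q (hopWeight d ξ * t) (y + c' • unitVec ν') + Q (hopWeight d ξ * t) y) := by
  unfold integrand; ring

/-- kernel: the pure second difference of the integrands is e^{−t}·[Q(θt)(y+e_ν) − 2Q(θt)(y) + Q(θt)(y−e_ν)].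
[cite: Balaban1983Higgs3, (2.10) p.426] -/
theorem integrand_pureDiff (ξ : ℝ) (y : ZSite d) (ν : Fin d) (t : ℝ) :
    integrand d ξ (y + unitVec ν) t - 2 * integrand d ξ y t + integrand d ξ (y - unitVec ν) t =
      Real.exp (-t) * (Q (hopWeight d ξ * t) (y + unitVec ν) - 2 * Q (hopWeight d ξ * t) y
        + Q (hopWeight d ξ * t) (y - unitVec ν)) := by
  unfold integrand; ring

/-- **Pointwise bound of the mixed second-difference integrand** (t > 0, y ∈ ℤ³, μ₀ a largest coordinate, ν ≠ ν′, steps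
c, c′ ∈ {±1}, R² = Σ_μy_μ², N = |y_{μ₀}|, θ = (6+ξ²)^{−1}): |e^{−t}Δ^{c′}_{ν′}Δ^{c}_νQ(θt)(y)| ≤
e^{−ξR/2}·[592(θt)^{−5/2} + (160/7)N(θt)^{−3} + (512/49)N²(θt)^{−7/2}]·e^{−(R²/14)/(θt)} + 96e^{−N}·(2/√(1+θt))³. [cite: Balaban1983Higgs3, (2.10) p.426] -/
theorem abs_integrand_mixedDiff_three_le (hξ : 0 < ξ) (y : ZSite 3) {ν ν' : Fin 3} (hne : ν ≠ ν') {c c' : ℤ}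
    (hc : c = 1 ∨ c = -1) (hc' : c' = 1 ∨ c' = -1) (μ₀ : Fin 3) (hmax : ∀ μ, (y μ).natAbs ≤ (y μ₀).natAbs)
    {t : ℝ} (ht : 0 < t) :
    |integrand 3 ξ (y + c • unitVec ν + c' • unitVec ν') t - integrand 3 ξ (y + c • unitVec ν) t
        - integrand 3 ξ (y + c' • unitVec ν') t + integrand 3 ξ y t| ≤
      Real.exp (-(ξ * Real.sqrt (rsq y) / 2)) *
          ((592 * (hopWeight 3 ξ * t) ^ (-(5 / 2 : ℝ))
              + 160 / 7 * ((y μ₀).natAbs : ℝ) * (hopWeight 3 ξ * t) ^ (-(3 : ℝ))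
              + 512 / 49 * ((y μ₀).natAbs : ℝ) ^ 2 * (hopWeight 3 ξ * t) ^ (-(7 / 2 : ℝ)))
            * Real.exp (-(rsq y / 14) / (hopWeight 3 ξ * t)))
        + 96 * Real.exp (-((y μ₀).natAbs : ℝ)) * (2 / Real.sqrt (1 + hopWeight 3 ξ * t)) ^ 3 := by
  rw [integrand_mixedDiff, abs_mul, abs_of_pos (Real.exp_pos _)]
  exact integrand_bound_of_ddQ hξ y μ₀ ht
    (ddQ_mixed_three_le (mul_pos (theta3_pos hξ) ht) y hne hc hc' μ₀ hmax)

/-- **Pointwise bound of the pure second-difference integrand** (t > 0, y ∈ ℤ³, μ₀ a largest coordinate, any ν):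
|e^{−t}[Q(θt)(y+e_ν) − 2Q(θt)(y) + Q(θt)(y−e_ν)]| ≤ e^{−ξR/2}·[592(θt)^{−5/2} + (160/7)N(θt)^{−3} + (512/49)N²(θt)^{−7/2}]·e^{−(R²/14)/(θt)}
+ 96e^{−N}·(2/√(1+θt))³. [cite: Balaban1983Higgs3, (2.10) p.426] -/
theorem abs_integrand_pureDiff_three_le (hξ : 0 < ξ) (y : ZSite 3) (ν : Fin 3) (μ₀ : Fin 3)
    (hmax : ∀ μ, (y μ).natAbs ≤ (y μ₀).natAbs) {t : ℝ} (ht : 0 < t) :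
    |integrand 3 ξ (y + unitVec ν) t - 2 * integrand 3 ξ y t + integrand 3 ξ (y - unitVec ν) t| ≤
      Real.exp (-(ξ * Real.sqrt (rsq y) / 2)) *
          ((592 * (hopWeight 3 ξ * t) ^ (-(5 / 2 : ℝ))
              + 160 / 7 * ((y μ₀).natAbs : ℝ) * (hopWeight 3 ξ * t) ^ (-(3 : ℝ))
              + 512 / 49 * ((y μ₀).natAbs : ℝ) ^ 2 * (hopWeight 3 ξ * t) ^ (-(7 / 2 : ℝ)))
            * Real.exp (-(rsq y / 14) / (hopWeight 3 ξ * t)))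
        + 96 * Real.exp (-((y μ₀).natAbs : ℝ)) * (2 / Real.sqrt (1 + hopWeight 3 ξ * t)) ^ 3 := by
  rw [integrand_pureDiff, abs_mul, abs_of_pos (Real.exp_pos _)]
  exact integrand_bound_of_ddQ hξ y μ₀ ht (ddQ_pure_three_le (mul_pos (theta3_pos hξ) ht) y ν μ₀ hmax)

end Integrand

end

end Literature.MathematicalPhysics.QuantumFieldTheory.Balaban1983to89.B3CxiSecondDifferenceKernel
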